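/-
Copyright (c) 2026. All rights reserved.
Released under Apache 2.0 license as described in the file LICENSE.
-/
import Literature.NumberTheory.ComplexMultiplication.CMTypeRank
import HarnessLib

/-!
# Ribet's method for a prime square: `2q ≤ Rank(Φ)` for a primitive CM type and an odd prime `q` with `q² ∣ n`
# (Dodson 1987, Theorem 1.12)

B. Dodson, *On the Mumford–Tate group of an abelian variety with complex multiplication*, J. Algebra 111 (1987)
49–73 [Dodson1987] (held `paper:doi-10-1016-0021-8693-87-90242-0`), p. 49: "Ribet's method also gives bounds of
the form `2q` for `q` a prime with `q²` dividing `n`, as is observed in Theorem 1.12"; pp. 54–55: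

> THEOREM 1.12. Let `q` be an odd prime for which `q²` divides `n`.  Then `B(n) ≥ 2q`.
> Proof. We consider the necessary modifications of the proof of the above Theorem 1.4.  Since `q²` divides `n`
> and `q` is a prime, `Gal(Kᶜ/ℚ)` has a subgroup of order `q²`.  First, we dispose of the case where there is an
> element `x` of order `q²`.  Since `x^q` must have nontrivial action on the orbit of types, there must be a type
> whose orbit under `x` has length `q²`.  Examining the ring `ℚ[X]/(X^{q²} − 1)`, we obtain a submodule of
> dimension `q(q − 1)` corresponding to the cyclotomic field generated by a primitive root of unity `ζ_{q²}` and
> establish our lower bound.  Next, we consider an elementary abelian subgroup of order `q²`, with generators `g`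
> and `h`.  Let `x ∈ ⟨g, h⟩`, and `y ∈ ⟨g, h⟩`, with `⟨x, y⟩ = ⟨g, h⟩`.  Our proof relies upon the assertion that
> if there is an element in the span of the orbit of types for which `x` has trivial action, but `y` has
> nontrivial action, then we obtain our bound.  In fact, we observe that under this hypothesis, the trivial
> submodule for the action of `⟨x⟩` has dimension at least `2 + (q − 1)`, while `x` has nontrivial action, so
> there is a complementary subspace of dimension at least `(q − 1)` and our rank is then at least `2q`.  Note that
> the linear independence relation of the previous proof holds in this case …  Now we claim that the above always
> holds.  Take a (primitive) type `Φ` in the `Gal(Kᶜ/ℚ)`-orbit on which `g` has nontrivial action … we consider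
> the elements `N_{⟨h⟩}(Φ), N_{⟨gh⟩}(Φ), …, N_{⟨g^{q−1}h⟩}(Φ)`.  If `g` is nontrivial on any of these, the above
> applies; so we consider the case where equations `g{N_{⟨gʲh⟩}(Φ)} = N_{⟨gʲh⟩}(Φ)` hold for `j = 0, 1, …, q − 1`.
> We add these `q` equations together, and observe that the terms may be rearranged so that the right-hand side
> satisfies `N_{⟨h⟩}(Φ) + N_{⟨gh⟩}(Φ) + ⋯ + N_{⟨g^{q−1}h⟩}(Φ) = q(Φ) + (q − 1)?…= q(Φ) + hN_{⟨g⟩}(Φ) + ⋯ +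
> h^{q−1}N_{⟨g⟩}(Φ)` … so `g(Φ) = Φ`, which contradicts our choice of `Φ`.

Setting as in `CMTypeRank.lean` / `CMTypeRankLowerBounds.lean` (a group `G` acting on the finite set `E` of
`2n` embeddings, `IsCMTypeWith ρ Φ`, `typeRank G Φ = dim W`, `W = span{𝟙_{g⁻¹Φ}}`, primitivity = the translates
separate points, `isPrimitive_iff_forall_eq`; for `k ∈ G`, `T_k f = f ∘ k` preserves `W`, and
`N_k = 1 + T_k + ⋯ + T_k^{q−1}`).

## Contents (everything kernel-proved; no named facts)

* `IsCMTypeWith.two_mul_le_typeRank_of_fixed_of_moved` — the KEY STEP of the printed proof ("if there is an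
  element in the span of the orbit of types for which `x` has trivial action, but `y` has nontrivial action, then
  … our rank is then at least `2q`"): `x, y ∈ G` commuting on `E` with `x^q = y^q = 1` on `E`, `x` moving a point,
  `w ∈ W` with `T_x w = w ≠ T_y w` ⟹ `2q ≤ rank` (vectors: `𝟙` and the full norm `N_xN_y𝟙_Φ` — independent by
  the parity of `q²`; `u, T_yu, …` for `u = T_yw − w ∈ W^x ∩ ker N_y`; `u', T_xu', …` for a translate moved by
  `x`, in `ker N_x`).
* `IsCMTypeWith.totient_sq_add_one_le_typeRank_of_smul_pow_sq_eq` — the CYCLIC CASE: `x ∈ G` with `x^{q²} = 1`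
  on `E` and `x^q` moving a translate ⟹ `q(q − 1) + 1 ≤ rank` (the `ℚ(ζ_{q²})`-submodule), hence `2q ≤ rank`.
* `exists_fixed_moved_of_commuting` — Dodson's CLAIM ("the above always holds"): for `g, k` commuting on `E`, of
  exponent `q` on `E`, `g` acting non-trivially, and `Φ` separating, some `x = gʲk`, `y = g` and `w = N_x v ∈ W`
  satisfy the key step's hypothesis (the printed sum over the `q` lines `⟨gʲk⟩`, reindexed `j ↦ ji (mod q)`).
* `IsCMTypeWith.two_mul_le_typeRank_of_prime_sq_dvd` (`…_of_isPrimitive`) — **Theorem 1.12**: for a transitive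
  action with `q² ∣ |E|`, `q` an odd prime (`⟺ q² ∣ n`), and a primitive type, `2q ≤ rank` (a subgroup of order
  `q²` of the image of `G → Sym(E)` by Sylow is cyclic or elementary abelian: `exists_of_card_eq_prime_sq`).
-/

set_option autoImplicit false

open scoped BigOperators

namespace Literature.NumberTheory.ComplexMultiplication

variable {G : Type*} [Group G] {E : Type*} [MulAction G E]

/-! ### Linear algebra of one translation operator `T = (f ↦ f ∘ g)` -/

section Operator

variable {V : Type*} [AddCommGroup V] [Module ℚ V]

/-- If the `n`-th cyclotomic polynomial of `T` kills `u ≠ 0`, then `u, Tu, …, T^{φ(n)−1}u` are linearly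
independent (`Φ_n` is irreducible over `ℚ` of degree `φ(n)`; a Bézout relation with a non-zero polynomial of
smaller degree killing `u` would kill `u`) — "a submodule of dimension `q(q − 1)` corresponding to the cyclotomic
field generated by `ζ_{q²}`". [cite: Dodson1987, Thm. 1.12 (proof, p. 55)] -/
private theorem linearIndependent_pow_apply_of_aeval_cyclotomic {n : ℕ} (hn : 0 < n) (T : V →ₗ[ℚ] V) {u : V}
    (hu : u ≠ 0) (hΦ : Polynomial.aeval T (Polynomial.cyclotomic n ℚ) u = 0) :
    LinearIndependent ℚ fun j : Fin (Nat.totient n) => (T ^ (j : ℕ)) u := by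
  rw [Fintype.linearIndependent_iff]
  intro c hc
  set q : Polynomial ℚ := ∑ j : Fin (Nat.totient n), Polynomial.C (c j) * Polynomial.X ^ (j : ℕ) with hq
  have hqv : Polynomial.aeval T q u = 0 := by
    rw [hq, map_sum, LinearMap.sum_apply, ← hc]
    refine Finset.sum_congr rfl fun j _ => ?_
    rw [map_mul, Polynomial.aeval_C, map_pow, Polynomial.aeval_X, Module.End.mul_apply,
      Module.algebraMap_end_apply]
  by_cases hq0 : q = 0
  · intro j
    have h1 := congrArg (fun r : Polynomial ℚ => r.coeff (j : ℕ)) hq0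
    simp only [hq, Polynomial.finsetSum_coeff, Polynomial.coeff_C_mul_X_pow, Polynomial.coeff_zero] at h1
    rw [Finset.sum_eq_single j (fun i _ hij => if_neg fun h => hij (Fin.ext h).symm)
      (fun h => absurd (Finset.mem_univ j) h), if_pos rfl] at h1
    exact h1
  · exfalso
    have hirr := Polynomial.cyclotomic.irreducible_rat hn
    have hndvd : ¬Polynomial.cyclotomic n ℚ ∣ q := by
      intro hd
      have h1 := Polynomial.degree_le_of_dvd hd hq0
      rw [Polynomial.degree_cyclotomic] at h1
      have h2 : q.degree < ((Nat.totient n : ℕ) : WithBot ℕ) := by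
        rw [hq]
        exact Polynomial.degree_sum_fin_lt c
      exact absurd (h1.trans_lt h2) (lt_irrefl _)
    obtain ⟨a, b, hab⟩ := hirr.coprime_iff_not_dvd.2 hndvd
    have h3 := congrArg (fun r : Polynomial ℚ => Polynomial.aeval T r u) hab
    simp only [map_add, map_mul, map_one, LinearMap.add_apply, Module.End.mul_apply, Module.End.one_apply,
      hΦ, hqv, map_zero, add_zero] at h3
    exact hu h3.symm

/-- `N = 1 + T + ⋯ + T^{q−1}` satisfies `N T = N = T N` when `T^q = 1`. [folklore] -/
private theorem norm_mul_eq_and (T N : V →ₗ[ℚ] V) {q : ℕ} (hTq : T ^ q = 1) (hN : N = ∑ i ∈ Finset.range q, T ^ i) :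
    N * T = N ∧ T * N = N := by
  have hs : ∑ i ∈ Finset.range (q + 1), T ^ i = N + 1 := by rw [Finset.sum_range_succ, hTq, ← hN]
  constructor
  · have h2 : ∑ i ∈ Finset.range (q + 1), T ^ i = N * T + 1 := by
      rw [Finset.sum_range_succ', pow_zero, hN, Finset.sum_mul]
      simp only [pow_succ]
    exact (add_right_cancel (hs.symm.trans h2)).symm
  · have h2 : ∑ i ∈ Finset.range (q + 1), T ^ i = T * N + 1 := by
      rw [Finset.sum_range_succ', pow_zero, hN, Finset.mul_sum]
      simp only [pow_succ']
    exact (add_right_cancel (hs.symm.trans h2)).symm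

/-- `N T^i = N`. [folklore] -/
private theorem norm_mul_pow_eq (T N : V →ₗ[ℚ] V) {q : ℕ} (hTq : T ^ q = 1) (hN : N = ∑ i ∈ Finset.range q, T ^ i)
    (i : ℕ) : N * T ^ i = N := by
  induction i with
  | zero => rw [pow_zero, mul_one]
  | succ i ih => rw [pow_succ, ← mul_assoc, ih, (norm_mul_eq_and T N hTq hN).1]

/-- `ker(T − 1) ∩ ker N = 0` (`N f = q f` on `T`-fixed `f`). [folklore] -/
private theorem disjoint_ker_sub_one_ker_norm (T N : V →ₗ[ℚ] V) {q : ℕ} (hq : q ≠ 0)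
    (hN : N = ∑ i ∈ Finset.range q, T ^ i) : Disjoint (LinearMap.ker (T - 1)) (LinearMap.ker N) := by
  rw [Submodule.disjoint_def]
  intro f hf0 hf1
  rw [LinearMap.mem_ker, LinearMap.sub_apply, Module.End.one_apply, sub_eq_zero] at hf0
  rw [LinearMap.mem_ker] at hf1
  have hTi : ∀ i : ℕ, (T ^ i) f = f := by
    intro i
    induction i with
    | zero => rw [pow_zero, Module.End.one_apply]
    | succ i ih => rw [pow_succ, Module.End.mul_apply, hf0, ih]
  have h2 : N f = (q : ℚ) • f := by
    rw [hN, LinearMap.sum_apply, Finset.sum_congr rfl fun i _ => hTi i, Finset.sum_const, Finset.card_range,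
      Nat.cast_smul_eq_nsmul]
  rw [h2] at hf1
  exact (smul_eq_zero.1 hf1).resolve_left (Nat.cast_ne_zero.2 hq)

/-- `Φ_q(T) = N` for `q` prime. [folklore] -/
private theorem aeval_cyclotomic_eq_norm (T N : V →ₗ[ℚ] V) {q : ℕ} [Fact q.Prime]
    (hN : N = ∑ i ∈ Finset.range q, T ^ i) : Polynomial.aeval T (Polynomial.cyclotomic q ℚ) = N := by
  rw [Polynomial.cyclotomic_prime, map_sum]
  simp only [map_pow, Polynomial.aeval_X]
  rw [← hN]

/-- `q − 1` independent iterates `u, Tu, …, T^{q−2}u` in `ker N` from any `v` with `Tv ≠ v` (`u = Tv − v`).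
[cite: Dodson1987, Thm. 1.4 (proof, p. 52)] -/
private theorem linearIndependent_iterates_sub (T N : V →ₗ[ℚ] V) {q : ℕ} [hq : Fact q.Prime] (hTq : T ^ q = 1)
    (hN : N = ∑ i ∈ Finset.range q, T ^ i) {v : V} (hv : T v ≠ v) :
    N (T v - v) = 0 ∧ LinearIndependent ℚ fun j : Fin (q - 1) => (T ^ (j : ℕ)) (T v - v) := by
  have hNu : N (T v - v) = 0 := by
    rw [map_sub, ← Module.End.mul_apply, (norm_mul_eq_and T N hTq hN).1, sub_self]
  refine ⟨hNu, ?_⟩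
  have hu0 : T v - v ≠ 0 := fun h0 => hv (sub_eq_zero.1 h0)
  have hΦ : Polynomial.aeval T (Polynomial.cyclotomic q ℚ) (T v - v) = 0 := by
    rw [aeval_cyclotomic_eq_norm T N hN, hNu]
  have h := linearIndependent_pow_apply_of_aeval_cyclotomic hq.out.pos T hu0 hΦ
  rwa [Nat.totient_prime hq.out] at h

end Operator

section Group

/-- The translation operator `T_g f = f ∘ g` on `ℚ^E` and its powers: `(T_gⁿ f)(x) = f(gⁿx)`. [folklore] -/
private theorem funLeft_pow_apply (g : G) (n : ℕ) (f : E → ℚ) (x : E) :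
    ((LinearMap.funLeft ℚ ℚ fun x : E => g • x) ^ n) f x = f (g ^ n • x) := by
  induction n generalizing f x with
  | zero => rw [pow_zero, pow_zero, one_smul, Module.End.one_apply]
  | succ n ih =>
    rw [pow_succ, Module.End.mul_apply, ih, LinearMap.funLeft_apply, ← mul_smul, ← pow_succ']

/-- `T_g^q = 1` when `g^q` acts trivially. [folklore] -/
private theorem funLeft_pow_eq_one {g : G} {q : ℕ} (hg : ∀ x : E, g ^ q • x = x) :
    (LinearMap.funLeft ℚ ℚ fun x : E => g • x) ^ q = 1 := by
  refine LinearMap.ext fun f => funext fun x => ?_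
  rw [funLeft_pow_apply, hg, Module.End.one_apply]

/-- `T_g T_h = T_h T_g` when `g, h` commute on `E`. [folklore] -/
private theorem funLeft_comm {g h : G} (hc : ∀ x : E, g • h • x = h • g • x) :
    (LinearMap.funLeft ℚ ℚ fun x : E => g • x) * (LinearMap.funLeft ℚ ℚ fun x : E => h • x) =
      (LinearMap.funLeft ℚ ℚ fun x : E => h • x) * (LinearMap.funLeft ℚ ℚ fun x : E => g • x) := by
  refine LinearMap.ext fun f => funext fun x => ?_
  simp only [Module.End.mul_apply, LinearMap.funLeft_apply, hc]

/-- `T_g` maps `W = span{𝟙_{k⁻¹Φ}}` into itself (`T_g 𝟙_{k⁻¹Φ} = 𝟙_{(kg)⁻¹Φ}`), and so do its powers.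
[cite: Dodson1987, Thm. 1.4 (proof, p. 52)] -/
private theorem funLeft_pow_mem_translateSpan (Φ : Set E) (g : G) (n : ℕ) {f : E → ℚ}
    (hf : f ∈ translateSpan G Φ) : ((LinearMap.funLeft ℚ ℚ fun x : E => g • x) ^ n) f ∈ translateSpan G Φ := by
  have hT : ∀ f ∈ translateSpan G Φ, (LinearMap.funLeft ℚ ℚ fun x : E => g • x) f ∈ translateSpan G Φ := by
    intro f hf
    have hmap : (translateSpan G Φ).map (LinearMap.funLeft ℚ ℚ fun x : E => g • x) ≤ translateSpan G Φ := by
      rw [translateSpan, Submodule.map_span, Submodule.span_le]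
      rintro _ ⟨_, ⟨k', rfl⟩, rfl⟩
      have h1 : (LinearMap.funLeft ℚ ℚ fun x : E => g • x) (translateInd Φ k') = translateInd Φ (k' * g) := by
        funext x
        rw [LinearMap.funLeft_apply, translateInd_mul]
      rw [h1]
      exact Submodule.subset_span ⟨k' * g, rfl⟩
    exact hmap ⟨f, hf, rfl⟩
  induction n generalizing f with
  | zero => rwa [pow_zero, Module.End.one_apply]
  | succ n ih => rw [pow_succ, Module.End.mul_apply]; exact ih (hT f hf)

/-- `N_g f ∈ W` for `f ∈ W`. [folklore] -/
private theorem norm_mem_translateSpan (Φ : Set E) (g : G) (q : ℕ) {f : E → ℚ} (hf : f ∈ translateSpan G Φ) :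
    (∑ i ∈ Finset.range q, (LinearMap.funLeft ℚ ℚ fun x : E => g • x) ^ i) f ∈ translateSpan G Φ := by
  rw [LinearMap.sum_apply]
  exact Submodule.sum_mem _ fun i _ => funLeft_pow_mem_translateSpan Φ g i hf

/-- A type whose translates separate points has a translate moved by any `g` acting non-trivially on `E` ("no
element of `Gal(Kᶜ/ℚ)` fixes every element of the orbit of `Φ`"). [cite: Dodson1987, Thm. 1.4 (proof, p. 52)] -/
private theorem exists_translate_moved (Φ : Set E) {g : G}
    (hsep : ∀ x y : E, (∀ k : G, k • x ∈ Φ ↔ k • y ∈ Φ) → x = y) (hg : ∃ z : E, g • z ≠ z) :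
    ∃ k : G, (LinearMap.funLeft ℚ ℚ fun x : E => g • x) (translateInd Φ k) ≠ translateInd Φ k := by
  obtain ⟨z, hz⟩ := hg
  by_contra hall
  push Not at hall
  refine hz (hsep (g • z) z fun k => ?_)
  have h1 := congrFun (hall k) z
  rw [LinearMap.funLeft_apply] at h1
  constructor
  · intro hm
    by_contra hn
    rw [translateInd_of_mem hm, translateInd_of_not_mem hn] at h1
    exact one_ne_zero h1
  · intro hm
    by_contra hn
    rw [translateInd_of_not_mem hn, translateInd_of_mem hm] at h1
    exact zero_ne_one h1

/-- **Parity**: an `ℕ`-valued weight `w ∈ ℚ^E` with `w(x) + w(ρx) = m` for an ODD `m` is not constant, so `𝟙, w`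
are linearly independent — Ribet's "adding the coefficients … `c = p/2` is not an integer for `p` odd", used for
the norm vectors `N_gΦ` (`m = q`) and `N_{⟨g,h⟩}Φ` (`m = q²`). [cite: Dodson1987, Thm. 1.4 (proof, p. 52)] -/
private theorem linearIndependent_one_of_odd [Nonempty E] (ρ : G) {w : E → ℚ} {m : ℕ} (hm : ¬2 ∣ m)
    (hnat : ∀ x : E, ∃ c : ℕ, w x = c) (hρ : ∀ x : E, w (ρ • x) = m - w x) :
    LinearIndependent ℚ ![(fun _ : E => (1 : ℚ)), w] := by
  obtain ⟨x₁⟩ := (inferInstance : Nonempty E)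
  rw [LinearIndependent.pair_iff]
  intro s t hst
  have hx : ∀ x : E, s + t * w x = 0 := fun x => by
    have h1 := congrFun hst x
    simpa using h1
  by_cases ht : t = 0
  · refine ⟨?_, ht⟩
    have h1 := hx x₁
    rwa [ht, zero_mul, add_zero] at h1
  · exfalso
    have h1 := hx x₁
    have h2 := hx (ρ • x₁)
    rw [hρ] at h2
    obtain ⟨c, hc⟩ := hnat x₁
    rw [hc] at h1 h2
    have h3 : t * ((m : ℚ) - 2 * c) = 0 := by linarith
    rcases mul_eq_zero.1 h3 with h4 | h4
    · exact ht h4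
    · have h5 : m = 2 * c := by exact_mod_cast (sub_eq_zero.1 h4)
      exact hm ⟨c, h5⟩

/-! ### Two commuting elements of exponent `q` on `E`: Dodson's sum over the lines `⟨gʲk⟩` -/

/-- `g^m` and `k^n` commute on `E` when `g, k` do. [folklore] -/
private theorem pow_smul_pow_comm {g k : G} (hc : ∀ z : E, g • k • z = k • g • z) (m n : ℕ) (z : E) :
    g ^ m • k ^ n • z = k ^ n • g ^ m • z := by
  have h1 : ∀ (n : ℕ) (z : E), g • k ^ n • z = k ^ n • g • z := by
    intro n
    induction n with
    | zero => intro z; rw [pow_zero, one_smul, one_smul]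
    | succ n ih => intro z; rw [pow_succ, mul_smul, mul_smul, ih, hc]
  induction m generalizing z with
  | zero => rw [pow_zero, one_smul, one_smul]
  | succ m ih => rw [pow_succ, mul_smul, mul_smul, h1, ih]

/-- `(gʲk)ⁿ = g^{jn}kⁿ` on `E` for commuting `g, k`. [folklore] -/
private theorem mul_pow_smul {g k : G} (hc : ∀ z : E, g • k • z = k • g • z) (j n : ℕ) (z : E) :
    (g ^ j * k) ^ n • z = g ^ (j * n) • k ^ n • z := by
  induction n generalizing z with
  | zero => simp only [pow_zero, mul_zero, one_smul]
  | succ n ih =>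
    calc (g ^ j * k) ^ (n + 1) • z = (g ^ j * k) ^ n • (g ^ j * k) • z := by rw [pow_succ, mul_smul]
      _ = g ^ (j * n) • k ^ n • g ^ j • k • z := by rw [ih, mul_smul]
      _ = g ^ (j * n) • g ^ j • k ^ n • k • z := by rw [← pow_smul_pow_comm hc j n (k • z)]
      _ = g ^ (j * (n + 1)) • k ^ (n + 1) • z := by rw [mul_add, mul_one, pow_add, pow_succ, mul_smul, mul_smul]

/-- `gⁿ = g^{n mod q}` on `E` when `g^q = 1` on `E`. [folklore] -/
private theorem pow_smul_eq_pow_mod_smul {g : G} {q : ℕ} (hgq : ∀ z : E, g ^ q • z = z) (n : ℕ) (z : E) :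
    g ^ n • z = g ^ (n % q) • z := by
  have hper : ∀ m : ℕ, g ^ (q * m) • z = z := by
    intro m
    induction m with
    | zero => rw [mul_zero, pow_zero, one_smul]
    | succ m ih => rw [Nat.mul_succ, pow_add, mul_smul, hgq, ih]
  conv_lhs => rw [← Nat.mod_add_div n q, pow_add, mul_smul, hper]

/-- Reindexing `j ↦ ji (mod q)` for `0 < i < q`, `q` prime: `Σ_{j<q} F(ji) = Σ_{a<q} F(a)` for a `q`-periodic `F`.
[folklore] -/
private theorem sum_range_mul_eq {q : ℕ} (hq : q.Prime) {i : ℕ} (hi0 : 0 < i) (hiq : i < q) (F : ℕ → ℚ)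
    (hF : ∀ n, F n = F (n % q)) : ∑ j ∈ Finset.range q, F (j * i) = ∑ a ∈ Finset.range q, F a := by
  have hcop : Nat.Coprime q i := (Nat.Prime.coprime_iff_not_dvd hq).2 (Nat.not_dvd_of_pos_of_lt hi0 hiq)
  let e : Fin q → Fin q := fun j => ⟨j.val * i % q, Nat.mod_lt _ hq.pos⟩
  have he : Function.Injective e := by
    intro j₁ j₂ hj
    have h1 : j₁.val * i % q = j₂.val * i % q := congrArg Fin.val hj
    have h2 : j₁.val ≡ j₂.val [MOD q] := Nat.ModEq.cancel_right_of_coprime hcop h1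
    have h3 : j₁.val % q = j₂.val % q := h2
    exact Fin.ext (by rw [← Nat.mod_eq_of_lt j₁.isLt, ← Nat.mod_eq_of_lt j₂.isLt]; exact h3)
  have hbij : Function.Bijective e := Finite.injective_iff_bijective.1 he
  rw [Finset.sum_range (fun j => F (j * i)), Finset.sum_range F,
    ← Equiv.sum_comp (Equiv.ofBijective e hbij) (fun a : Fin q => F a)]
  refine Finset.sum_congr rfl fun j _ => ?_
  rw [Equiv.ofBijective_apply]
  exact hF (j.val * i)

/-- **Dodson's claim** ("Now we claim that the above always holds"): for `g, k ∈ G` commuting on `E` with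
`g^q = k^q = 1` on `E` (`q` prime), `g` acting non-trivially, and a type `Φ` whose translates separate points,
there are `j < q` and `w ∈ W` fixed by `T_{gʲk}` but not by `T_g` — "Take a (primitive) type `Φ` … on which `g`
has nontrivial action … we consider the elements `N_{⟨h⟩}(Φ), N_{⟨gh⟩}(Φ), …, N_{⟨g^{q−1}h⟩}(Φ)`.  If `g` is
nontrivial on any of these, the above applies; so we consider the case where `g{N_{⟨gʲh⟩}(Φ)} = N_{⟨gʲh⟩}(Φ)`
hold for `j = 0, 1, …, q − 1`.  We add these `q` equations together, and observe that the terms may be rearranged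
… so `g(Φ) = Φ`, which contradicts our choice of `Φ`": here `Σ_{j<q} N_{gʲk}v = q·v + Σ_{1≤i<q} Σ_{a<q} v∘(gᵃkⁱ)`
pointwise, the double sum is `T_g`-invariant, so `T_g`-invariance of every `N_{gʲk}v` forces `T_g v = v`.
[cite: Dodson1987, Thm. 1.12 (proof, p. 55)] -/
theorem exists_fixed_moved_of_commuting (Φ : Set E) {q : ℕ} (hq : q.Prime) {g k : G}
    (hgq : ∀ z : E, g ^ q • z = z) (hkq : ∀ z : E, k ^ q • z = z) (hc : ∀ z : E, g • k • z = k • g • z)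
    (hsep : ∀ a b : E, (∀ c : G, c • a ∈ Φ ↔ c • b ∈ Φ) → a = b) (hg : ∃ z : E, g • z ≠ z) :
    ∃ j < q, ∃ w ∈ translateSpan G Φ,
      (LinearMap.funLeft ℚ ℚ fun z : E => (g ^ j * k) • z) w = w ∧
        (LinearMap.funLeft ℚ ℚ fun z : E => g • z) w ≠ w := by
  classical
  obtain ⟨c, hcv⟩ := exists_translate_moved Φ hsep hg
  obtain ⟨v, hv⟩ : ∃ v : E → ℚ, v = translateInd Φ c := ⟨_, rfl⟩
  rw [← hv] at hcv
  have hvW : v ∈ translateSpan G Φ := hv ▸ Submodule.subset_span ⟨c, rfl⟩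
  -- `(gʲk)^q = 1` on `E`
  have hxq : ∀ (j : ℕ) (z : E), (g ^ j * k) ^ q • z = z := fun j z => by
    rw [mul_pow_smul hc j q z, hkq, pow_smul_eq_pow_mod_smul hgq, Nat.mul_mod_left, pow_zero, one_smul]
  by_contra hall
  push Not at hall
  -- the norm `w_j = N_{gʲk} v` is fixed by `gʲk`, hence (by `hall`) by `g`: pointwise
  have hwj : ∀ j < q, ∀ z : E, ∑ i ∈ Finset.range q, v ((g ^ j * k) ^ i • g • z) =
      ∑ i ∈ Finset.range q, v ((g ^ j * k) ^ i • z) := by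
    intro j hj z
    have hW := norm_mem_translateSpan Φ (g ^ j * k) q hvW
    have hTq := funLeft_pow_eq_one (E := E) (hxq j)
    have hfix := (norm_mul_eq_and (LinearMap.funLeft ℚ ℚ fun z : E => (g ^ j * k) • z) _ hTq rfl).2
    have hfix' : (LinearMap.funLeft ℚ ℚ fun z : E => (g ^ j * k) • z)
        ((∑ i ∈ Finset.range q, (LinearMap.funLeft ℚ ℚ fun z : E => (g ^ j * k) • z) ^ i) v) =
        (∑ i ∈ Finset.range q, (LinearMap.funLeft ℚ ℚ fun z : E => (g ^ j * k) • z) ^ i) v := by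
      rw [← Module.End.mul_apply, hfix]
    have h1 := congrFun (hall j hj _ hW hfix') z
    rw [LinearMap.funLeft_apply, LinearMap.sum_apply, Finset.sum_apply, Finset.sum_apply] at h1
    simpa only [funLeft_pow_apply] using h1
  -- the double sum, split at `i = 0` and reindexed
  have hsplit : ∀ z : E, ∑ j ∈ Finset.range q, ∑ i ∈ Finset.range q, v ((g ^ j * k) ^ i • z) =
      (q : ℚ) * v z + ∑ i ∈ Finset.Ico 1 q, ∑ a ∈ Finset.range q, v (g ^ a • k ^ i • z) := by
    intro z
    have h1 : ∀ j ∈ Finset.range q, ∑ i ∈ Finset.range q, v ((g ^ j * k) ^ i • z) =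
        v z + ∑ i ∈ Finset.Ico 1 q, v (g ^ (j * i) • k ^ i • z) := by
      intro j _
      rw [Finset.range_eq_Ico, Finset.sum_eq_sum_Ico_succ_bot hq.pos, pow_zero, one_smul]
      congr 1
      exact Finset.sum_congr rfl fun i _ => by rw [mul_pow_smul hc]
    rw [Finset.sum_congr rfl h1, Finset.sum_add_distrib, Finset.sum_const, Finset.card_range, nsmul_eq_mul,
      Finset.sum_comm]
    congr 1
    refine Finset.sum_congr rfl fun i hi => ?_
    rw [Finset.mem_Ico] at hi
    exact sum_range_mul_eq hq hi.1 hi.2 (fun n => v (g ^ n • k ^ i • z))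
      (fun n => by
        show v (g ^ n • k ^ i • z) = v (g ^ (n % q) • k ^ i • z)
        rw [pow_smul_eq_pow_mod_smul hgq n])
  -- the inner sums `Σ_{a<q} v(gᵃ kⁱ z)` are `g`-invariant
  have hinv : ∀ (i : ℕ) (z : E), ∑ a ∈ Finset.range q, v (g ^ a • k ^ i • g • z) =
      ∑ a ∈ Finset.range q, v (g ^ a • k ^ i • z) := by
    intro i z
    have h1 : ∀ a ∈ Finset.range q, v (g ^ a • k ^ i • g • z) = v (g ^ (a + 1) • k ^ i • z) := by
      intro a _
      have h2 : k ^ i • g • z = g • k ^ i • z := by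
        have := pow_smul_pow_comm hc 1 i z
        rw [pow_one] at this
        exact this.symm
      rw [h2, ← mul_smul, ← pow_succ]
    rw [Finset.sum_congr rfl h1]
    have h3 := Finset.sum_range_succ (fun a => v (g ^ a • k ^ i • z)) q
    have h4 := Finset.sum_range_succ' (fun a => v (g ^ a • k ^ i • z)) q
    rw [h3, hgq, pow_zero, one_smul] at h4
    exact (add_right_cancel h4).symm
  -- conclusion: `T_g v = v`
  apply hcv
  funext z
  rw [LinearMap.funLeft_apply]
  have h1 : ∑ j ∈ Finset.range q, ∑ i ∈ Finset.range q, v ((g ^ j * k) ^ i • g • z) =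
      ∑ j ∈ Finset.range q, ∑ i ∈ Finset.range q, v ((g ^ j * k) ^ i • z) :=
    Finset.sum_congr rfl fun j hj => hwj j (Finset.mem_range.1 hj) z
  rw [hsplit, hsplit, Finset.sum_congr rfl fun i _ => hinv i z] at h1
  have h2 : (q : ℚ) * v (g • z) = (q : ℚ) * v z := by linarith
  exact mul_left_cancel₀ (Nat.cast_ne_zero.2 hq.ne_zero) h2

/-! ### Groups of order `q²` -/

/-- A group of order `q²` either has an element of order `q²` or two commuting elements `a, b` of exponent `q`
with `b ∉ ⟨a⟩` (`aʲb ≠ 1` for all `j`) — "an element `x` of order `q²` … [or] an elementary Abelian subgroup of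
order `q²`, with generators `g` and `h`". [cite: Dodson1987, Thm. 1.12 (proof, pp. 54–55)] -/
private theorem exists_of_card_eq_prime_sq {H : Type*} [Group H] [Finite H] {q : ℕ} (hq : q.Prime)
    (hH : Nat.card H = q ^ 2) :
    (∃ σ : H, orderOf σ = q ^ 2) ∨
      ∃ a b : H, a ≠ 1 ∧ (∀ j : ℕ, a ^ j * b ≠ 1) ∧ a * b = b * a ∧ a ^ q = 1 ∧ b ^ q = 1 := by
  classical
  haveI : Fact q.Prime := ⟨hq⟩
  by_cases hcyc : ∃ σ : H, orderOf σ = q ^ 2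
  · exact Or.inl hcyc
  right
  push Not at hcyc
  have hexp : ∀ σ : H, σ ^ q = 1 := by
    intro σ
    have hd : orderOf σ ∣ q ^ 2 := hH ▸ orderOf_dvd_natCard σ
    obtain ⟨i, hi, he⟩ := (Nat.dvd_prime_pow hq).1 hd
    interval_cases i
    · rw [pow_zero] at he
      rw [orderOf_eq_one_iff.1 he, one_pow]
    · rw [pow_one] at he
      rw [← he]
      exact pow_orderOf_eq_one σ
    · exact absurd he (hcyc σ)
  haveI : Nontrivial H := by
    rw [← Finite.one_lt_card_iff_nontrivial, hH]
    exact Nat.one_lt_pow two_ne_zero hq.one_lt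
  obtain ⟨a, ha⟩ := exists_ne (1 : H)
  have hza : Nat.card (Subgroup.zpowers a) = q := by
    rw [Nat.card_zpowers]
    exact orderOf_eq_prime (hexp a) ha
  obtain ⟨b, hb⟩ : ∃ b : H, b ∉ Subgroup.zpowers a := by
    by_contra hall
    push Not at hall
    have htop : Subgroup.zpowers a = ⊤ := (Subgroup.eq_top_iff' _).2 hall
    have h1 : Nat.card (Subgroup.zpowers a) = Nat.card H := by rw [htop, Subgroup.card_top]
    rw [hza, hH, pow_two] at h1
    have h2 : q * 1 = q * q := by rw [mul_one]; exact h1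
    exact hq.one_lt.ne (Nat.eq_of_mul_eq_mul_left hq.pos h2)
  have hcomm := (IsPGroup.isMulCommutative_of_card_eq_prime_sq hH).is_comm.comm
  refine ⟨a, b, ha, fun j hj => hb ?_, hcomm a b, hexp a, hexp b⟩
  rw [eq_inv_of_mul_eq_one_right hj]
  exact Subgroup.inv_mem _ (Subgroup.pow_mem _ (Subgroup.mem_zpowers a) j)

namespace IsCMTypeWith

variable {ρ : G} {Φ : Set E} (h : IsCMTypeWith ρ Φ)
include h

/-- `gⁿ` commutes with `ρ` on `E`. [folklore] -/
private theorem pow_smul_rho (g : G) (n : ℕ) (x : E) : g ^ n • ρ • x = ρ • g ^ n • x := by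
  induction n generalizing x with
  | zero => rw [pow_zero, one_smul, one_smul]
  | succ n ih => rw [pow_succ, mul_smul, mul_smul, h.comm, ih]

variable [Fintype E]

/-! ### The key step: a vector of `W` fixed by `x` and moved by `y` -/

/-- **Dodson's key step** (proof of Thm. 1.12): `x, y ∈ G` commuting on `E`, with `x^q = y^q = 1` on `E` for an
odd prime `q`, `x` acting non-trivially on `E`, `Φ` separating, and a vector `w ∈ W` with `T_x w = w` but
`T_y w ≠ w` — "the trivial submodule for the action of `⟨x⟩` has dimension at least `2 + (q − 1)`, while `x` has
nontrivial action, so there is a complementary subspace of dimension at least `(q − 1)` and our rank is then at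
least `2q`": the `2q` independent vectors are `𝟙, N_xN_y𝟙_Φ ∈ W^{x,y}` (independent by the parity of `q²`),
`u, T_yu, …, T_y^{q−2}u ∈ W^x ∩ ker N_y` (`u = T_yw − w`), and `u', T_xu', …, T_x^{q−2}u' ∈ ker N_x` (`u'` from
a translate moved by `x`). [cite: Dodson1987, Thm. 1.12 (proof, pp. 54–55)] -/
theorem two_mul_le_typeRank_of_fixed_of_moved {q : ℕ} (hq : q.Prime) (hq2 : q ≠ 2) {x y : G}
    (hxq : ∀ z : E, x ^ q • z = z) (hyq : ∀ z : E, y ^ q • z = z) (hxy : ∀ z : E, x • y • z = y • x • z)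
    (hx : ∃ z : E, x • z ≠ z) (hsep : ∀ a b : E, (∀ k : G, k • a ∈ Φ ↔ k • b ∈ Φ) → a = b)
    {w : E → ℚ} (hwW : w ∈ translateSpan G Φ)
    (hxw : (LinearMap.funLeft ℚ ℚ fun z : E => x • z) w = w)
    (hyw : (LinearMap.funLeft ℚ ℚ fun z : E => y • z) w ≠ w) : 2 * q ≤ typeRank G Φ := by
  classical
  haveI : Fact q.Prime := ⟨hq⟩
  obtain ⟨z₀, _⟩ := hx
  haveI : Nonempty E := ⟨z₀⟩
  -- operators
  obtain ⟨Tx, hTx⟩ : ∃ T : (E → ℚ) →ₗ[ℚ] (E → ℚ), T = LinearMap.funLeft ℚ ℚ fun z : E => x • z := ⟨_, rfl⟩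
  obtain ⟨Ty, hTy⟩ : ∃ T : (E → ℚ) →ₗ[ℚ] (E → ℚ), T = LinearMap.funLeft ℚ ℚ fun z : E => y • z := ⟨_, rfl⟩
  have hTx_apply : ∀ (f : E → ℚ) (z : E), Tx f z = f (x • z) := fun f z => by rw [hTx]; rfl
  have hTy_apply : ∀ (f : E → ℚ) (z : E), Ty f z = f (y • z) := fun f z => by rw [hTy]; rfl
  have hTxq : Tx ^ q = 1 := by rw [hTx]; exact funLeft_pow_eq_one hxq
  have hTyq : Ty ^ q = 1 := by rw [hTy]; exact funLeft_pow_eq_one hyq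
  have hcomm : Tx * Ty = Ty * Tx := by rw [hTx, hTy]; exact funLeft_comm hxy
  obtain ⟨Nx, hNx⟩ : ∃ N : (E → ℚ) →ₗ[ℚ] (E → ℚ), N = ∑ i ∈ Finset.range q, Tx ^ i := ⟨_, rfl⟩
  obtain ⟨Ny, hNy⟩ : ∃ N : (E → ℚ) →ₗ[ℚ] (E → ℚ), N = ∑ i ∈ Finset.range q, Ty ^ i := ⟨_, rfl⟩
  have hNxTx := norm_mul_eq_and Tx Nx hTxq hNx
  have hNyTy := norm_mul_eq_and Ty Ny hTyq hNy
  have hTyNx : Ty * Nx = Nx * Ty := by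
    rw [hNx, Finset.mul_sum, Finset.sum_mul]
    refine Finset.sum_congr rfl fun i _ => ?_
    exact ((Commute.pow_right (show Commute Ty Tx from hcomm.symm) i)).eq
  have hTxpow_Ty : ∀ i : ℕ, Tx * Ty ^ i = Ty ^ i * Tx := fun i =>
    (Commute.pow_right (show Commute Tx Ty from hcomm) i).eq
  -- membership in W
  have hWx : ∀ (n : ℕ) (f : E → ℚ), f ∈ translateSpan G Φ → (Tx ^ n) f ∈ translateSpan G Φ := by
    intro n f hf; rw [hTx]; exact funLeft_pow_mem_translateSpan Φ x n hf
  have hWy : ∀ (n : ℕ) (f : E → ℚ), f ∈ translateSpan G Φ → (Ty ^ n) f ∈ translateSpan G Φ := by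
    intro n f hf; rw [hTy]; exact funLeft_pow_mem_translateSpan Φ y n hf
  have hWNx : ∀ f ∈ translateSpan G Φ, Nx f ∈ translateSpan G Φ := by
    intro f hf; rw [hNx, LinearMap.sum_apply]; exact Submodule.sum_mem _ fun i _ => hWx i f hf
  have hWNy : ∀ f ∈ translateSpan G Φ, Ny f ∈ translateSpan G Φ := by
    intro f hf; rw [hNy, LinearMap.sum_apply]; exact Submodule.sum_mem _ fun i _ => hWy i f hf
  -- Family A: `1` and the full norm `wA = Nx (Ny 1_Φ)`
  obtain ⟨wA, hwA⟩ : ∃ f : E → ℚ, f = Nx (Ny (translateInd Φ (1 : G))) := ⟨_, rfl⟩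
  have hwAW : wA ∈ translateSpan G Φ := hwA ▸ hWNx _ (hWNy _ (Submodule.subset_span ⟨1, rfl⟩))
  have hwA_apply : ∀ z : E, wA z = ∑ i ∈ Finset.range q, ∑ j ∈ Finset.range q,
      translateInd Φ (1 : G) (y ^ j • x ^ i • z) := by
    intro z
    rw [hwA, hNx, LinearMap.sum_apply, Finset.sum_apply]
    refine Finset.sum_congr rfl fun i _ => ?_
    rw [hTx, funLeft_pow_apply, hNy, LinearMap.sum_apply, Finset.sum_apply]
    refine Finset.sum_congr rfl fun j _ => ?_
    rw [hTy, funLeft_pow_apply]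
  have hnatA : ∀ z : E, ∃ c : ℕ, wA z = c := by
    intro z
    refine ⟨∑ i ∈ Finset.range q, ∑ j ∈ Finset.range q, if y ^ j • x ^ i • z ∈ Φ then 1 else 0, ?_⟩
    rw [hwA_apply, Nat.cast_sum]
    refine Finset.sum_congr rfl fun i _ => ?_
    rw [Nat.cast_sum]
    refine Finset.sum_congr rfl fun j _ => ?_
    by_cases hij : y ^ j • x ^ i • z ∈ Φ
    · rw [if_pos hij, Nat.cast_one, translateInd_of_mem (by rwa [one_smul])]
    · rw [if_neg hij, Nat.cast_zero, translateInd_of_not_mem (by rwa [one_smul])]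
  have hρA : ∀ z : E, wA (ρ • z) = (q ^ 2 : ℕ) - wA z := by
    intro z
    rw [hwA_apply, hwA_apply]
    have h1 : ∀ i ∈ Finset.range q, ∑ j ∈ Finset.range q, translateInd Φ (1 : G) (y ^ j • x ^ i • ρ • z) =
        ∑ j ∈ Finset.range q, (1 - translateInd Φ (1 : G) (y ^ j • x ^ i • z)) := by
      intro i _
      refine Finset.sum_congr rfl fun j _ => ?_
      rw [h.pow_smul_rho x i z, h.pow_smul_rho y j, h.translateInd_rho_smul]
    rw [Finset.sum_congr rfl h1]
    simp only [Finset.sum_sub_distrib, Finset.sum_const, Finset.card_range, nsmul_eq_mul, mul_one]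
    push_cast
    ring
  have hq2' : ¬2 ∣ q ^ 2 := fun hd => hq2 ((Nat.prime_dvd_prime_iff_eq Nat.prime_two hq).1
    (Nat.prime_two.dvd_of_dvd_pow hd)).symm
  have hliA := linearIndependent_one_of_odd ρ hq2' hnatA hρA
  have hTx1 : Tx (fun _ : E => (1 : ℚ)) = fun _ => 1 := by funext z; rw [hTx_apply]
  have hTy1 : Ty (fun _ : E => (1 : ℚ)) = fun _ => 1 := by funext z; rw [hTy_apply]
  have hTxwA : Tx wA = wA := by rw [hwA, ← Module.End.mul_apply, hNxTx.2]
  have hTywA : Ty wA = wA := by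
    rw [hwA, ← Module.End.mul_apply, hTyNx, Module.End.mul_apply, ← Module.End.mul_apply Ty Ny, hNyTy.2]
  -- Family B: `u = Ty w - w`, fixed by `Tx`, killed by `Ny`
  have hyw' : Ty w ≠ w := by rwa [hTy]
  obtain ⟨hNyu, hliB⟩ := linearIndependent_iterates_sub Ty Ny hTyq hNy hyw'
  have hxw' : Tx w = w := by rw [hTx]; exact hxw
  have hTxu : Tx (Ty w - w) = Ty w - w := by
    rw [map_sub, ← Module.End.mul_apply, hcomm, Module.End.mul_apply, hxw']
  -- Family C: a translate moved by `x`
  obtain ⟨k, hk⟩ := exists_translate_moved Φ hsep ⟨z₀, ‹x • z₀ ≠ z₀›⟩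
  have hk' : Tx (translateInd Φ k) ≠ translateInd Φ k := by rwa [hTx]
  obtain ⟨hNxu', hliC⟩ := linearIndependent_iterates_sub Tx Nx hTxq hNx hk'
  -- the subspaces
  have hdisj_y := disjoint_ker_sub_one_ker_norm Ty Ny hq.ne_zero hNy
  have hdisj_x := disjoint_ker_sub_one_ker_norm Tx Nx hq.ne_zero hNx
  have hA : Submodule.span ℚ (Set.range ![(fun _ : E => (1 : ℚ)), wA]) ≤
      LinearMap.ker (Tx - 1) ⊓ LinearMap.ker (Ty - 1) := by
    rw [Submodule.span_le]
    rintro _ ⟨j, rfl⟩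
    simp only [SetLike.mem_coe, Submodule.mem_inf, LinearMap.mem_ker, LinearMap.sub_apply, Module.End.one_apply,
      sub_eq_zero]
    fin_cases j
    · exact ⟨hTx1, hTy1⟩
    · exact ⟨hTxwA, hTywA⟩
  have hB : Submodule.span ℚ (Set.range fun j : Fin (q - 1) => (Ty ^ (j : ℕ)) (Ty w - w)) ≤
      LinearMap.ker (Tx - 1) ⊓ LinearMap.ker Ny := by
    rw [Submodule.span_le]
    rintro _ ⟨j, rfl⟩
    simp only [SetLike.mem_coe, Submodule.mem_inf, LinearMap.mem_ker, LinearMap.sub_apply, Module.End.one_apply,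
      sub_eq_zero]
    constructor
    · rw [← Module.End.mul_apply, hTxpow_Ty, Module.End.mul_apply, hTxu]
    · rw [← Module.End.mul_apply, norm_mul_pow_eq Ty Ny hTyq hNy, hNyu]
  have hC : Submodule.span ℚ (Set.range fun j : Fin (q - 1) => (Tx ^ (j : ℕ)) (Tx (translateInd Φ k) - translateInd Φ k)) ≤
      LinearMap.ker Nx := by
    rw [Submodule.span_le]
    rintro _ ⟨j, rfl⟩
    rw [SetLike.mem_coe, LinearMap.mem_ker, ← Module.End.mul_apply, norm_mul_pow_eq Tx Nx hTxq hNx, hNxu']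
  have hdisjAB : Disjoint (LinearMap.ker (Tx - 1) ⊓ LinearMap.ker (Ty - 1))
      (LinearMap.ker (Tx - 1) ⊓ LinearMap.ker Ny) :=
    hdisj_y.mono inf_le_right inf_le_right
  have hliAB := hliA.sum_type hliB (hdisjAB.mono hA hB)
  have hAB : Submodule.span ℚ (Set.range (Sum.elim ![(fun _ : E => (1 : ℚ)), wA]
      fun j : Fin (q - 1) => (Ty ^ (j : ℕ)) (Ty w - w))) ≤ LinearMap.ker (Tx - 1) := by
    rw [Submodule.span_le]
    rintro _ ⟨i, rfl⟩
    rcases i with j | j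
    · exact (hA (Submodule.subset_span ⟨j, rfl⟩)).1
    · exact (hB (Submodule.subset_span ⟨j, rfl⟩)).1
  have hli := hliAB.sum_type hliC (hdisj_x.mono hAB hC)
  -- everything lies in W
  have hsub : Set.range (Sum.elim (Sum.elim ![(fun _ : E => (1 : ℚ)), wA]
      fun j : Fin (q - 1) => (Ty ^ (j : ℕ)) (Ty w - w))
      fun j : Fin (q - 1) => (Tx ^ (j : ℕ)) (Tx (translateInd Φ k) - translateInd Φ k)) ⊆
      (translateSpan G Φ : Set (E → ℚ)) := by
    rintro _ ⟨i, rfl⟩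
    rcases i with (j | j) | j
    · fin_cases j
      · exact h.one_mem_translateSpan
      · exact hwAW
    · exact hWy j _ (Submodule.sub_mem _ (by simpa using hWy 1 w hwW) hwW)
    · exact hWx j _ (Submodule.sub_mem _ (by simpa using hWx 1 _ (Submodule.subset_span ⟨k, rfl⟩))
        (Submodule.subset_span ⟨k, rfl⟩))
  have h1 := finrank_span_eq_card hli
  simp only [Fintype.card_sum, Fintype.card_fin] at h1
  have h2 := Submodule.finrank_mono (Submodule.span_le.2 hsub)
  rw [h1] at h2
  rw [typeRank_eq_finrank_translateSpan]
  have := hq.two_le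
  omega

/-! ### The cyclic case: an element of order `q²` on `E` -/

/-- **The cyclic case of Thm. 1.12**: if `x ∈ G` acts on `E` with `x^{q²} = 1` and `x^q` moves some translate of
`Φ` (e.g. `x^q ≠ 1` on `E` and `Φ` separating), then `q(q − 1) + 1 ≤ rank` — "Examining the ring
`ℚ[X]/(X^{q²} − 1)`, we obtain a submodule of dimension `q(q − 1)` corresponding to the cyclotomic field generated
by a primitive root of unity `ζ_{q²}`": `u = (T^q − 1)v ≠ 0` satisfies `Φ_{q²}(T)u = (T^{q²} − 1)v = 0`, giving
`φ(q²) = q(q − 1)` independent iterates in `ker(1 + T + ⋯ + T^{q²−1})`, plus `𝟙`.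
[cite: Dodson1987, Thm. 1.12 (proof, p. 55)] -/
theorem totient_sq_add_one_le_typeRank_of_smul_pow_sq_eq {q : ℕ} (hq : q.Prime) {x : G}
    (hxq : ∀ z : E, x ^ (q ^ 2) • z = z)
    (hmove : ∃ k : G, ∃ z : E, ¬((k * x ^ q) • z ∈ Φ ↔ k • z ∈ Φ)) :
    q * (q - 1) + 1 ≤ typeRank G Φ := by
  classical
  obtain ⟨k, z₁, hkz⟩ := hmove
  haveI : Nonempty E := ⟨z₁⟩
  obtain ⟨T, hT⟩ : ∃ T : (E → ℚ) →ₗ[ℚ] (E → ℚ), T = LinearMap.funLeft ℚ ℚ fun z : E => x • z := ⟨_, rfl⟩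
  have hTq2 : T ^ (q ^ 2) = 1 := by rw [hT]; exact funLeft_pow_eq_one hxq
  obtain ⟨N, hN⟩ : ∃ N : (E → ℚ) →ₗ[ℚ] (E → ℚ), N = ∑ i ∈ Finset.range (q ^ 2), T ^ i := ⟨_, rfl⟩
  have hq2pos : 0 < q ^ 2 := pow_pos hq.pos 2
  have hWx : ∀ (n : ℕ) (f : E → ℚ), f ∈ translateSpan G Φ → (T ^ n) f ∈ translateSpan G Φ := by
    intro n f hf; rw [hT]; exact funLeft_pow_mem_translateSpan Φ x n hf
  -- v = 1_{k⁻¹Φ}, u = T^q v - v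
  obtain ⟨v, hv⟩ : ∃ v : E → ℚ, v = translateInd Φ k := ⟨_, rfl⟩
  have hvW : v ∈ translateSpan G Φ := hv ▸ Submodule.subset_span ⟨k, rfl⟩
  have hu0 : (T ^ q) v - v ≠ 0 := by
    intro h0
    have h1 := congrFun (sub_eq_zero.1 h0) z₁
    rw [hT, funLeft_pow_apply, hv, ← translateInd_mul] at h1
    refine hkz ⟨fun hm => ?_, fun hm => ?_⟩
    · by_contra hn
      rw [translateInd_of_mem hm, translateInd_of_not_mem hn] at h1
      exact one_ne_zero h1
    · by_contra hn
      rw [translateInd_of_not_mem hn, translateInd_of_mem hm] at h1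
      exact zero_ne_one h1
  have huW : (T ^ q) v - v ∈ translateSpan G Φ := Submodule.sub_mem _ (hWx q v hvW) hvW
  -- Φ_{q²}(T) u = 0 : `∏_{d ∣ q²} Φ_d = X^{q²} - 1` and `Φ_1 Φ_q = X^q - 1`
  have hΦ : Polynomial.aeval T (Polynomial.cyclotomic (q ^ 2) ℚ) ((T ^ q) v - v) = 0 := by
    have hprod : Polynomial.cyclotomic (q ^ 2) ℚ * (Polynomial.X ^ q - 1 : Polynomial ℚ) =
        (Polynomial.X ^ (q ^ 2) - 1 : Polynomial ℚ) := by
      have h1 := Polynomial.prod_cyclotomic_eq_X_pow_sub_one hq2pos ℚ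
      rw [Nat.divisors_prime_pow hq 2] at h1
      rw [Finset.prod_map] at h1
      simp only [Finset.prod_range_succ, Finset.prod_range_zero, one_mul, Function.Embedding.coeFn_mk,
        pow_zero, pow_one, Polynomial.cyclotomic_one] at h1
      have h2 := Polynomial.prod_cyclotomic_eq_X_pow_sub_one hq.pos ℚ
      rw [Nat.Prime.divisors hq, Finset.prod_insert (by simp [hq.one_lt.ne]), Finset.prod_singleton,
        Polynomial.cyclotomic_one] at h2
      -- h1 : (X - 1) * cyclotomic q * cyclotomic (q^2) = X^(q^2) - 1 ; h2 : (X - 1) * cyclotomic q = X^q - 1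
      rw [← h2, ← h1]
      ring
    have h3 : Polynomial.aeval T (Polynomial.X ^ q - 1 : Polynomial ℚ) v = (T ^ q) v - v := by
      simp only [map_sub, map_pow, Polynomial.aeval_X, map_one, LinearMap.sub_apply, Module.End.one_apply]
    rw [← h3, ← Module.End.mul_apply, ← map_mul, hprod]
    simp only [map_sub, map_pow, Polynomial.aeval_X, map_one, hTq2, sub_self, LinearMap.zero_apply]
  have hli := linearIndependent_pow_apply_of_aeval_cyclotomic hq2pos T hu0 hΦ
  rw [Nat.totient_prime_pow hq two_pos] at hli
  -- N u = 0 and the family lies in ker N, `1` in ker (T - 1)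
  have hNTpow : ∀ i : ℕ, N * T ^ i = N := norm_mul_pow_eq T N hTq2 hN
  have hNu : N ((T ^ q) v - v) = 0 := by
    rw [map_sub, ← Module.End.mul_apply, hNTpow, sub_self]
  have hdisj := disjoint_ker_sub_one_ker_norm T N hq2pos.ne' hN
  have hli1 : LinearIndependent ℚ ![(fun _ : E => (1 : ℚ))] := by
    rw [Fintype.linearIndependent_iff]
    intro c hc i
    fin_cases i
    have h1 := congrFun hc z₁
    simpa using h1
  have hA : Submodule.span ℚ (Set.range ![(fun _ : E => (1 : ℚ))]) ≤ LinearMap.ker (T - 1) := by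
    rw [Submodule.span_le]
    rintro _ ⟨j, rfl⟩
    fin_cases j
    rw [SetLike.mem_coe, LinearMap.mem_ker, LinearMap.sub_apply, Module.End.one_apply, sub_eq_zero]
    funext z
    simp [hT]
  have hB : Submodule.span ℚ (Set.range fun j : Fin (q ^ (2 - 1) * (q - 1)) => (T ^ (j : ℕ)) ((T ^ q) v - v)) ≤
      LinearMap.ker N := by
    rw [Submodule.span_le]
    rintro _ ⟨j, rfl⟩
    rw [SetLike.mem_coe, LinearMap.mem_ker, ← Module.End.mul_apply, hNTpow, hNu]
  have hli' := hli1.sum_type hli (hdisj.mono hA hB)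
  have hsub : Set.range (Sum.elim ![(fun _ : E => (1 : ℚ))]
      fun j : Fin (q ^ (2 - 1) * (q - 1)) => (T ^ (j : ℕ)) ((T ^ q) v - v)) ⊆ (translateSpan G Φ : Set (E → ℚ)) := by
    rintro _ ⟨i, rfl⟩
    rcases i with j | j
    · fin_cases j
      exact h.one_mem_translateSpan
    · exact hWx j _ huW
  have h1 := finrank_span_eq_card hli'
  simp only [Fintype.card_sum, Fintype.card_fin] at h1
  have h2 := Submodule.finrank_mono (Submodule.span_le.2 hsub)
  rw [h1] at h2
  rw [typeRank_eq_finrank_translateSpan]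
  have h3 : q ^ (2 - 1) * (q - 1) = q * (q - 1) := by norm_num
  omega

/-! ### Theorem 1.12 -/

/-- **Dodson's Theorem 1.12 (Ribet's method for `q² ∣ n`)**: for a transitive action of `G` on `E` with `q² ∣ |E|`,
`q` an odd prime (equivalently `q² ∣ n`, `|E| = 2n`), and a type `Φ` whose translates separate the points of `E`
(a primitive type), `2q ≤ rank Φ` — "Let `q` be an odd prime for which `q²` divides `n`.  Then `B(n) ≥ 2q`."
Proof as printed: a subgroup of order `q²` of the image of `G → Sym(E)` (Sylow; "`Gal(Kᶜ/ℚ)` has a subgroup of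
order `q²`") is cyclic (`totient_sq_add_one_le_typeRank_of_smul_pow_sq_eq`, `q(q − 1) + 1 ≥ 2q`) or elementary
abelian (`exists_fixed_moved_of_commuting` and the key step `two_mul_le_typeRank_of_fixed_of_moved`).
[cite: Dodson1987, Thm. 1.12 (pp. 54–55)] -/
theorem two_mul_le_typeRank_of_prime_sq_dvd [Nonempty E] [MulAction.IsPretransitive G E] {q : ℕ}
    (hq : q.Prime) (hq2 : q ≠ 2) (hdvd : q ^ 2 ∣ Fintype.card E)
    (hsep : ∀ a b : E, (∀ k : G, k • a ∈ Φ ↔ k • b ∈ Φ) → a = b) : 2 * q ≤ typeRank G Φ := by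
  classical
  haveI : Fact q.Prime := ⟨hq⟩
  obtain ⟨x₀⟩ := (inferInstance : Nonempty E)
  set f : G →* Equiv.Perm E := MulAction.toPermHom G E with hf
  haveI : MulAction.IsPretransitive f.range E := ⟨fun a b => by
    obtain ⟨g, hg⟩ := MulAction.exists_smul_eq G a b
    exact ⟨⟨f g, g, rfl⟩, by rw [Subgroup.smul_def, Equiv.Perm.smul_def]; simpa [hf] using hg⟩⟩
  have hdvd' : q ^ 2 ∣ Nat.card f.range := by
    have h1 := (MulAction.stabilizer f.range x₀).index_mul_card
    rw [MulAction.index_stabilizer_of_transitive, Nat.card_eq_fintype_card] at h1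
    exact hdvd.trans (Dvd.intro _ h1)
  obtain ⟨P, hP⟩ := Sylow.exists_subgroup_card_pow_prime q hdvd'
  -- `P ↪ Sym(E)` and lifts to `G`
  obtain ⟨ι, hι⟩ : ∃ ι : P →* Equiv.Perm E, ι = f.range.subtype.comp P.subtype := ⟨_, rfl⟩
  have hιinj : Function.Injective ι := by
    rw [hι]
    exact Subtype.val_injective.comp Subtype.val_injective
  have key : ∀ σ : P, ∃ g : G, f g = ι σ := fun σ => by
    obtain ⟨g, hg⟩ := MonoidHom.mem_range.1 (σ : f.range).2
    exact ⟨g, by rw [hg, hι]; rfl⟩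
  have smul_eq_of : ∀ {g : G}, f g = 1 → ∀ z : E, g • z = z := fun {g} e z => by
    simpa [hf] using Equiv.congr_fun e z
  have exists_ne_of : ∀ {g : G}, f g ≠ 1 → ∃ z : E, g • z ≠ z := fun {g} hne => by
    by_contra hall
    push Not at hall
    exact hne (Equiv.ext fun z => by simpa [hf] using hall z)
  have h3q : 3 ≤ q := by have := hq.two_le; omega
  rcases exists_of_card_eq_prime_sq hq hP with ⟨σ, hσ⟩ | ⟨a, b, ha, hab, hcomm, haq, hbq⟩
  · -- an element of order `q²`
    obtain ⟨g, hg⟩ := key σ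
    have hord : orderOf (f g) = q ^ 2 := by rw [hg, orderOf_injective ι hιinj σ, hσ]
    have h1 : ∀ z : E, g ^ (q ^ 2) • z = z :=
      smul_eq_of (by rw [map_pow, ← hord, pow_orderOf_eq_one])
    have h2 : ∃ z : E, g ^ q • z ≠ z := by
      refine exists_ne_of fun e => ?_
      rw [map_pow] at e
      have hd := orderOf_dvd_of_pow_eq_one e
      rw [hord, pow_two] at hd
      have h4 : q * q ≤ q * 1 := by rw [mul_one]; exact Nat.le_of_dvd hq.pos hd
      exact absurd (Nat.le_of_mul_le_mul_left h4 hq.pos) (not_le.2 hq.one_lt)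
    obtain ⟨k, hk⟩ := exists_translate_moved Φ hsep h2
    have hmove : ∃ k : G, ∃ z : E, ¬((k * g ^ q) • z ∈ Φ ↔ k • z ∈ Φ) := by
      by_contra hall
      push Not at hall
      apply hk
      funext z
      rw [LinearMap.funLeft_apply, ← translateInd_mul]
      by_cases hm : k • z ∈ Φ
      · rw [translateInd_of_mem hm, translateInd_of_mem ((hall k z).2 hm)]
      · rw [translateInd_of_not_mem hm, translateInd_of_not_mem fun hh => hm ((hall k z).1 hh)]
    have h5 := h.totient_sq_add_one_le_typeRank_of_smul_pow_sq_eq hq h1 hmove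
    have h6 : 3 * (q - 1) ≤ q * (q - 1) := Nat.mul_le_mul_right (q - 1) h3q
    omega
  · -- an elementary abelian subgroup `⟨a, b⟩`
    obtain ⟨g, hg⟩ := key a
    obtain ⟨k, hk⟩ := key b
    have hgq : ∀ z : E, g ^ q • z = z := smul_eq_of (by rw [map_pow, hg, ← map_pow, haq, map_one])
    have hkq : ∀ z : E, k ^ q • z = z := smul_eq_of (by rw [map_pow, hk, ← map_pow, hbq, map_one])
    have hc : ∀ z : E, g • k • z = k • g • z := fun z => by
      have e : f (g * k) = f (k * g) := by rw [map_mul, map_mul, hg, hk, ← map_mul, hcomm, map_mul]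
      have e' := Equiv.congr_fun e z
      simpa [hf, mul_smul] using e'
    have hgnt : ∃ z : E, g • z ≠ z := exists_ne_of fun e => ha (hιinj (by rw [← hg, e, map_one]))
    have hxnt : ∀ j : ℕ, ∃ z : E, (g ^ j * k) • z ≠ z := fun j =>
      exists_ne_of fun e => hab j (hιinj (by rw [map_mul, map_pow, ← hg, ← hk, ← map_pow, ← map_mul, e, map_one]))
    obtain ⟨j, -, w, hwW, hxw, hyw⟩ := exists_fixed_moved_of_commuting Φ hq hgq hkq hc hsep hgnt
    have hxq : ∀ z : E, (g ^ j * k) ^ q • z = z := fun z => by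
      rw [mul_pow_smul hc j q z, hkq, pow_smul_eq_pow_mod_smul hgq, Nat.mul_mod_left, pow_zero, one_smul]
    have hxy : ∀ z : E, (g ^ j * k) • g • z = g • (g ^ j * k) • z := fun z => by
      rw [mul_smul, mul_smul, ← hc z, ← mul_smul (g ^ j) g, ← mul_smul g (g ^ j), ← pow_succ, ← pow_succ']
    exact h.two_mul_le_typeRank_of_fixed_of_moved hq hq2 hxq hgq hxy (hxnt j) hsep hwW hxw hyw

/-- **Dodson's Theorem 1.12 for the tree's `IsPrimitive`** (Shimura Prop. 26 form): `2q ≤ rank` for a primitive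
type on a transitive `G`-set `E` with `q² ∣ |E|`, `q` an odd prime. [cite: Dodson1987, Thm. 1.12 (pp. 54–55)] -/
theorem two_mul_le_typeRank_of_prime_sq_dvd_of_isPrimitive [Nonempty E] [MulAction.IsPretransitive G E]
    {q : ℕ} (hq : q.Prime) (hq2 : q ≠ 2) (hdvd : q ^ 2 ∣ Fintype.card E) {φh : E}
    (hprim : IsPrimitive G Φ φh) : 2 * q ≤ typeRank G Φ :=
  h.two_mul_le_typeRank_of_prime_sq_dvd hq hq2 hdvd ((isPrimitive_iff_forall_eq Φ φh).1 hprim)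

end IsCMTypeWith

end Group

end Literature.NumberTheory.ComplexMultiplication
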